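import Summits.Ventures.HSemireg.WedgePointPairPowersPerQRank
import Summits.Ventures.HSemireg.FormulaNSqueeze
import Summits.Ventures.HSemireg.WedgeBoxPerQOverlap

/-!
# Venture HSemireg — per-`q` blocks of the `n`-fold box of `m`-dimensional point pairs, companion: TOTAL RANK = NUMBER OF CLASSES,
# and THE BLOCKS OVERLAP BY EXACTLY `n·[t^k]P_m(t)^{n−1}` — `Σ_{q ≤ mn} rank_q = rank(F_n) + n·rank(F_{n−1})` in every degree `k`,
# for EVERY factor dimension `m ≥ 1` (the generalisation of `WedgeSurfacePowersPerQOverlap.lean`, `m = 2`)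

HONEST FRAMING. Part of the Lean index of the computation cell `pub-hsemireg` (seat p10 gen 4, Sunday typer «UNIFORM-IN-n»).
Finite-dimensional EXTERIOR ALGEBRA over a field and integer / natural-number polynomial arithmetic ONLY: no variety, no cohomology
theory, no sheaf, no Ext group, no semiregularity map is constructed here; nothing here says that HC / HC_CM / HC_AV holds; no
Literature fact is declared or used.  Custodian versions: STRUCTURE.md v1.0-SIGNED 9b196a05977dd067 (§1.1 C10 / C13; red-5's reader
caution «Σ_q block ranks ≠ rank σ — the blocks overlap»), theory/FORMULA-N.md PART A §4.1″ (th-6) / PART B §E, §G (th-7).  Model and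
dictionary (quoted, NOT asserted): `WedgePointPairPowers.lean` (the `n`-fold box `F = f₀ ∧ ⋯ ∧ f_{n−1}` of `m`-dimensional point pairs
`f_i = a·E_{X_i} + c·E_{Y_i}` on `(m+m)n` generators; `q` = number of `X`-generators missing from the target monomial); the per-`q`
rank theorem: `WedgePointPairPowersPerQRank.lean` (`rank_q = genCount m n k q = [t^k u^q] G_{m,n}`).

THIS FILE (the companions of the general per-`q` rank theorem, as `WedgeSurfacePowersPerQOverlap.lean` is for surfaces and
`WedgeBoxPerQOverlap.lean` for two factors): §1 **the range of `θ ↦ θ ∧ F` on `⋀^k` is the span of ALL class vectors of degree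
`k`, and its rank is their number `|Kset m n k|`** (disjoint supports) — so, comparing with p10 gen 3's Künneth iteration
`finrank_range_pairBox`, **the number of classes of degree `k` is `[t^k] (pairPoly m)ⁿ = [t^k] P_m(t)ⁿ`** for every `n`
(`card_Kset`; `n = 0`: the one empty class); §2 the class of `f` reaches exactly `z(f) + 1` blocks (`q = q_f + jm`, `j ≤ z(f)`),
all of index `≤ mn` (the blocks of index `> mn` are ZERO, `finrank_range_blockProj_wedge_pairBox_eq_zero_of_lt` — every sum
`Σ_{q ≤ mn}` below runs over all blocks), hence **`Σ_{q ≤ mn} |Fset m n k q| = |Kset m n k| + Σ_{f ∈ Kset m n k} z(f)`** (`m ≥ 1`);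
§3 counting the pairs
(class, empty block) by the empty block: `Σ_{f ∈ Kset m (n+1) k} z(f) = (n+1)·|Kset m n k|` (`Fin.insertNth` / `Fin.removeNth`);
§4 **THE OVERLAP IDENTITY** for every `m ≥ 1`, every `n ≥ 1`, every `k`, `a, c ≠ 0`:
`Σ_{q ≤ mn} rank(q-block of θ ↦ θ ∧ F_n ∣ ⋀^k) = [t^k]P_mⁿ + n·[t^k]P_m^{n−1}` (`sum_finrank_range_blockProj_wedge_pairBox`; in
terms of total ranks `= rank(F_n ∣ ⋀^k) + n·rank(F_{n−1} ∣ ⋀^k)` for `n ≥ 2`, `…_eq_add`) — each empty factor's source `1` is ONE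
vector `a E_{X_i} + c E_{Y_i}` with components in the two blocks `+0` and `+m` (th-6's coincidence, for any `m`); the single factor
(`n = 1`): `Σ_{q ≤ m} rank_q = [t^k]P_m + [k = 0]` — the blocks are disjoint in every degree `k ≥ 1` and overlap by exactly one in
degree `0` (th-6's `k = 0` exception of `WedgeBoxPerQOverlap.lean`, for one factor); instance `270 = 126 + 3·48` (the pre-registered
`m = 3`, `n = 3`, degree-2 row `(36,9,54,36,36,54,9,36,0,0)` of `FormulaNPerQUniform.lean` summed; `126`, `48` of
`WedgePointPairPowers.coeff_pairPoly_three`); as pure arithmetic of p10's enumerator: `Σ_{q ≤ m(n+1)} genCount m (n+1) k q =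
[t^k]P_m^{n+1} + (n+1)·[t^k]P_mⁿ` (`sum_genCount`, from the linear algebra over `ℚ`); §5 th-7 §G's `η`-WEIGHTS for every `m`:
`w = mn − k − 2q` on the degree-`(k + mn)`
monomials (`kweight_eq`) — the weight blocks ARE the `q`-blocks; §6 the EDGE `m = 2`: `pairPoly 2 = surfPoly` (so §4 at `m = 2` is
the surface identity's right-hand side `[t^k](1+4t+t²)ⁿ + n·[t^k](1+4t+t²)^{n−1}`, in this file's block layout); §7 **(S2) ⇒ PER-q**
(`finrank_range_blockProj_sigma_of_saturation`): with the bridge `σ ∘ ev = (θ ↦ θ ∧ F_n)` and the extremal count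
`dim Ext^k = [t^k]P_mⁿ` as HYPOTHESES BY VALUE (FORMULA-N THEOREM S, `FormulaNSqueeze.lean`), `ev` is onto, `σ` injective and the
`q`-blocks of `σ` ITSELF have ranks `genCount m n k q`; `Ext2` is NOT identified with a sheaf's Ext.
Namespace `Summit.Ventures.HSemireg.Wedge.PairPowers`, new names only; nothing of th-7 / th-6 / p3 / p10 g0–g3 restated.
-/

open Module Set Set.powersetCard Polynomial

namespace Summit.Ventures.HSemireg.Wedge.PairPowers

open Summit.Ventures.HSemireg.Wedge Summit.Ventures.HSemireg.Wedge.Kunneth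

variable (K : Type*) [Field K] {m : ℕ} {n : ℕ}

/-! ## §1. The total rank is the number of classes -/

/-- a class vector is non-zero (it reaches the block `q_f`; `m ≥ 1`, `a, c ≠ 0`). -/
lemma vec_ne_zero (hm : 1 ≤ m) {a c : K} (ha : a ≠ 0) (hc : c ≠ 0) (f : Fin n → Opt m) : vec K a c f ≠ 0 := by
  intro h
  have h1 := (blockProj_vec_ne_zero_iff K hm ha hc f (qff f)).mpr ⟨0, Nat.zero_le _, by ring⟩
  rw [h, map_zero] at h1
  exact h1 rfl

variable (m n) in
/-- the option data of degree `k` (all classes of degree-`k` sources). -/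
def Kset (k : ℕ) : Finset (Fin n → Opt m) := Finset.univ.filter fun f => kf f = k

/-- membership in `Kset`. -/
lemma mem_Kset {k : ℕ} {f : Fin n → Opt m} : f ∈ Kset m n k ↔ kf f = k := by
  simp [Kset]

/-- **the range of `θ ↦ θ ∧ F` on `⋀^k K^{(m+m)n}` is the span of the class vectors of degree `k`** (`m ≥ 1`, `a, c ≠ 0`). -/
theorem range_wedge_pairBox_eq_span (hm : 1 ≤ m) {a c : K} (ha : a ≠ 0) (hc : c ≠ 0) (k : ℕ) :
    LinearMap.range (wedge K (Fin ((m + m) * n)) k (pairBox K (m := m) (n := n) a c)) =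
      Submodule.span K (Set.range fun f : Kset m n k => vec K a c f.1) := by
  apply le_antisymm
  · rw [range_wedge, Submodule.span_le]
    rintro _ ⟨s, hs, rfl⟩
    rw [SetLike.mem_coe]
    show B K (Fin ((m + m) * n)) s * pairBox K (m := m) (n := n) a c ∈ _
    obtain ⟨μ, -, e⟩ := B_mul_pairBox K hm ha hc s
    rw [e]
    apply Submodule.smul_mem
    rcases lprod_eq_smul_vec K hm hc s with h0 | ⟨f, hf, Λ, hΛ⟩
    · rw [h0]; exact Submodule.zero_mem _
    · rw [hΛ]
      exact Submodule.smul_mem _ _ (Submodule.subset_span ⟨⟨f, mem_Kset.mpr (hf.trans hs)⟩, rfl⟩)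
  · rw [Submodule.span_le]
    rintro _ ⟨⟨f, hf⟩, rfl⟩
    obtain ⟨μ, hμ, e⟩ := B_mul_pairBox K hm ha hc (src f)
    have hv : vec K a c f = μ⁻¹ • (B K (Fin ((m + m) * n)) (src f) * pairBox K (m := m) (n := n) a c) := by
      rw [e, smul_smul, inv_mul_cancel₀ hμ, one_smul]; rfl
    rw [SetLike.mem_coe]
    show vec K a c f ∈ _
    rw [hv]
    apply Submodule.smul_mem
    exact ⟨⟨B K (Fin ((m + m) * n)) (src f), SurfacePowers.B_mem_exteriorPower K (by rw [← kf_eq_card_src, mem_Kset.mp hf])⟩, rfl⟩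

/-- **TOTAL RANK = NUMBER OF CLASSES**: `rank(θ ↦ θ ∧ F ∣ ⋀^k K^{(m+m)n}) = |Kset m n k|` (`m ≥ 1`, `a, c ≠ 0`). -/
theorem finrank_range_wedge_pairBox_eq_card (hm : 1 ≤ m) {a c : K} (ha : a ≠ 0) (hc : c ≠ 0) (k : ℕ) :
    finrank K (LinearMap.range (wedge K (Fin ((m + m) * n)) k (pairBox K (m := m) (n := n) a c))) = (Kset m n k).card := by
  rw [range_wedge_pairBox_eq_span K hm ha hc, finrank_span_eq_card, Fintype.card_coe]
  apply SurfacePowers.linearIndependent_of_disjoint_support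
  · rintro ⟨f, -⟩
    exact vec_ne_zero K hm ha hc f
  · rintro ⟨f, hf⟩ ⟨f', hf'⟩ hne T
    exact coord_vec_eq_zero_or K hm ha hc (fun h => hne (Subtype.ext h)) T

/-- no blocks: the one empty class, of degree `0`. -/
lemma card_Kset_zero (k : ℕ) : (Kset m 0 k).card = if k = 0 then 1 else 0 := by
  have hk : ∀ f : Fin 0 → Opt m, kf f = 0 := fun f => by simp [kf]
  have hu : (Finset.univ : Finset (Fin 0 → Opt m)).card = 1 := by simp
  rw [Kset]
  split_ifs with h
  · rw [Finset.filter_true_of_mem (fun f _ => (hk f).trans h.symm), hu]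
  · rw [Finset.filter_false_of_mem (fun f _ => fun e => h (e.symm.trans (hk f))), Finset.card_empty]

/-- so **the number of classes of degree `k` is `[t^k] (pairPoly m)ⁿ`** (`= [t^k] P_m(t)ⁿ`; `m ≥ 1`, every `n`) — two kernel rank
computations of the same map (p10 gen 3's Künneth iteration `finrank_range_pairBox` and the class count) compared, over `ℚ`; at
`n = 0` both sides are `[k = 0]`. -/
theorem card_Kset (hm : 1 ≤ m) (k : ℕ) : (Kset m n k).card = (pairPoly m ^ n).coeff k := by
  rcases Nat.eq_zero_or_pos n with rfl | hn
  · rw [card_Kset_zero, pow_zero, coeff_one]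
  · rw [← finrank_range_wedge_pairBox_eq_card ℚ hm one_ne_zero one_ne_zero, finrank_range_pairBox ℚ hm hn one_ne_zero one_ne_zero]

/-! ## §2. The blocks a class reaches, counted: `z(f) + 1` of them, all of index `≤ mn` -/

/-- fixed part plus `m` times the empty blocks never exceeds `mn` (so every reached block has index `≤ mn`). -/
lemma qff_add_mul_zf_le (f : Fin n → Opt m) : qff f + m * zf f ≤ m * n := by
  have h2 : qff f + m * zf f = ∑ i, (lqf m (f i) + m * lz m (f i)) := by
    rw [Finset.sum_add_distrib, qff, zf, Finset.mul_sum]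
  rw [h2]
  exact (Finset.sum_le_sum fun i _ => lqf_add_lz_le (f i)).trans (by simp [mul_comm])

/-- the blocks reached by the class of `f`, among `0, …, mn`, are the `z(f) + 1` values `q_f + jm`, `j ≤ z(f)`. -/
lemma filter_reach_eq_image (f : Fin n → Opt m) :
    (Finset.range (m * n + 1)).filter (fun q => ∃ j, j ≤ zf f ∧ q = qff f + m * j) =
      (Finset.range (zf f + 1)).image fun j => qff f + m * j := by
  ext q
  simp only [Finset.mem_filter, Finset.mem_range, Finset.mem_image]
  have := qff_add_mul_zf_le f
  constructor
  · rintro ⟨-, j, hj, rfl⟩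
    exact ⟨j, by omega, rfl⟩
  · rintro ⟨j, hj, rfl⟩
    have hjm : m * j ≤ m * zf f := Nat.mul_le_mul_left m (by omega)
    exact ⟨by omega, j, by omega, rfl⟩

/-- their number is `z(f) + 1` (`m ≥ 1`: the shifts are distinct). -/
lemma card_filter_reach (hm : 1 ≤ m) (f : Fin n → Opt m) :
    ((Finset.range (m * n + 1)).filter fun q => ∃ j, j ≤ zf f ∧ q = qff f + m * j).card = zf f + 1 := by
  rw [filter_reach_eq_image,
    Finset.card_image_of_injective _ (fun j j' (h : qff f + m * j = qff f + m * j') =>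
      Nat.eq_of_mul_eq_mul_left hm (by omega)),
    Finset.card_range]

/-- **SUM OF THE BLOCK COUNTS = NUMBER OF CLASSES + NUMBER OF (CLASS, EMPTY BLOCK) PAIRS**:
`Σ_{q ≤ mn} |Fset m n k q| = |Kset m n k| + Σ_{f ∈ Kset m n k} z(f)` (`m ≥ 1`). -/
theorem sum_card_Fset (hm : 1 ≤ m) (k : ℕ) :
    ∑ q ∈ Finset.range (m * n + 1), (Fset m n k q).card = (Kset m n k).card + ∑ f ∈ Kset m n k, zf f := by
  have h1 : ∀ q, (Fset m n k q).card = ∑ f ∈ Kset m n k, (if ∃ j, j ≤ zf f ∧ q = qff f + m * j then 1 else 0) := by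
    intro q
    rw [Finset.sum_boole, Nat.cast_id, Kset, Finset.filter_filter]
    congr 1
    ext f
    rw [mem_Fset, Finset.mem_filter, and_iff_right (Finset.mem_univ f)]
  simp_rw [h1]
  rw [Finset.sum_comm, Finset.card_eq_sum_ones, ← Finset.sum_add_distrib]
  refine Finset.sum_congr rfl fun f _ => ?_
  rw [Finset.sum_boole, Nat.cast_id, card_filter_reach hm, add_comm]

/-! ## §3. `Σ_{f ∈ Kset m (n+1) k} z(f) = (n+1) · |Kset m n k|`: remove the empty block -/

/-- inserting an empty block at position `i` does not change the degree. -/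
lemma kf_insertNth {n : ℕ} (i : Fin (n + 1)) (g : Fin n → Opt m) : kf (Fin.insertNth i (oEmpty m) g) = kf g := by
  rw [kf, Fin.sum_univ_succAbove _ i, Fin.insertNth_apply_same]
  simp only [Fin.insertNth_apply_succAbove]
  rw [show ((oEmpty m).1).card = 0 from Finset.card_empty, zero_add]
  rfl

/-- the classes of degree `k` with block `i` empty correspond to the classes of degree `k` on the other `n` blocks. -/
lemma card_filter_empty_at {n : ℕ} (i : Fin (n + 1)) (k : ℕ) :
    ((Kset m (n + 1) k).filter fun f => (f i).1 = ∅).card = (Kset m n k).card := by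
  have hinj : Function.Injective (Fin.insertNth (α := fun _ : Fin (n + 1) => Opt m) i (oEmpty m)) :=
    fun g g' h => (Fin.insertNth_inj.mp h).2
  rw [← Finset.card_image_of_injective (Kset m n k) hinj]
  congr 1
  ext f
  simp only [Finset.mem_filter, Finset.mem_image, mem_Kset]
  constructor
  · rintro ⟨hk, h0⟩
    have h0' : f i = oEmpty m := (lz_eq (f i)).2.mp h0
    refine ⟨Fin.removeNth i f, ?_, ?_⟩
    · rw [← kf_insertNth i, ← h0', Fin.insertNth_self_removeNth, hk]
    · rw [← h0', Fin.insertNth_self_removeNth]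
  · rintro ⟨g, hg, rfl⟩
    exact ⟨by rw [kf_insertNth, hg], by rw [Fin.insertNth_apply_same]; rfl⟩

/-- **`Σ_{f ∈ Kset m (n+1) k} z(f) = (n + 1) · |Kset m n k|`** (count the pairs (class, empty block) by the empty block). -/
theorem sum_zf_Kset (n k : ℕ) : ∑ f ∈ Kset m (n + 1) k, zf f = (n + 1) * (Kset m n k).card := by
  simp_rw [zf_eq_card, Finset.card_filter]
  rw [Finset.sum_comm]
  simp_rw [← Finset.card_filter, card_filter_empty_at]
  rw [Finset.sum_const, Finset.card_univ, Fintype.card_fin, smul_eq_mul]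

/-- no class reaches a block of index `> mn`: `Fset m n k q = ∅` for `mn < q`. -/
lemma Fset_eq_empty_of_lt {k q : ℕ} (hq : m * n < q) : Fset m n k q = ∅ := by
  rw [Finset.eq_empty_iff_forall_notMem]
  intro f hf
  obtain ⟨-, j, hj, hjq⟩ := mem_Fset.mp hf
  have h1 := qff_add_mul_zf_le f
  have h2 : m * j ≤ m * zf f := Nat.mul_le_mul_left m hj
  omega

/-- so **the blocks of index `> mn` of `θ ↦ θ ∧ F` are zero in every degree** — the sums `Σ_{q ≤ mn}` below run over ALL blocks
(`m ≥ 1`, `a, c ≠ 0`). -/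
theorem finrank_range_blockProj_wedge_pairBox_eq_zero_of_lt (hm : 1 ≤ m) {a c : K} (ha : a ≠ 0) (hc : c ≠ 0) {k q : ℕ}
    (hq : m * n < q) :
    finrank K (LinearMap.range (blockProj K m n q ∘ₗ wedge K (Fin ((m + m) * n)) k (pairBox K (m := m) (n := n) a c))) = 0 := by
  rw [finrank_range_blockProj_wedge_pairBox_eq_card K hm ha hc, Fset_eq_empty_of_lt hq, Finset.card_empty]

/-! ## §4. THE OVERLAP IDENTITY for the blocks of the `n`-fold box of `m`-dimensional point pairs -/

/-- **THE BLOCKS OF THE `n`-FOLD BOX OF `m`-DIMENSIONAL POINT PAIRS OVERLAP BY EXACTLY `n · [t^k] P_m(t)^{n−1}`**: for every field,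
every `m ≥ 1`, every `n ≥ 1` (written `n + 1`), every `k` and `a, c ≠ 0`,
`Σ_{q ≤ m(n+1)} rank(q-block of θ ↦ θ ∧ F_{n+1} ∣ ⋀^k) = [t^k](pairPoly m)^{n+1} + (n+1)·[t^k](pairPoly m)ⁿ` (= total rank + one term
`[t^k]P_mⁿ` per empty factor: the source `1` of an empty factor is ONE vector `a E_X + c E_Y` with components in two blocks `q` and
`q + m` — th-6's coincidence; the general-`m` form of `WedgeSurfacePowersPerQOverlap.sum_finrank_range_blockProj_wedge_surfaceBox`
and of the two-factor identity `Σ_q rank_q = rank + 2r_k` of `WedgeBoxPerQOverlap.sum_finrank_range_blockProj_eq`).  At `n + 1 = 1`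
(one factor) the right-hand side is `[t^k]P_m + [k = 0]`: th-6's `k = 0` exception, and disjoint blocks in every degree `k ≥ 1`. -/
theorem sum_finrank_range_blockProj_wedge_pairBox (hm : 1 ≤ m) (n : ℕ) {a c : K} (ha : a ≠ 0) (hc : c ≠ 0) (k : ℕ) :
    ∑ q ∈ Finset.range (m * (n + 1) + 1),
        finrank K (LinearMap.range (blockProj K m (n + 1) q ∘ₗ
          wedge K (Fin ((m + m) * (n + 1))) k (pairBox K (m := m) (n := n + 1) a c))) =
      (pairPoly m ^ (n + 1)).coeff k + (n + 1) * (pairPoly m ^ n).coeff k := by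
  simp_rw [finrank_range_blockProj_wedge_pairBox_eq_card K hm ha hc]
  rw [sum_card_Fset hm, sum_zf_Kset, card_Kset hm, card_Kset hm]

/-- in terms of the total ranks (`n + 1 ≥ 2`): `Σ_{q ≤ m(n+1)} rank_q = rank(θ ↦ θ ∧ F_{n+1} ∣ ⋀^k) + (n+1) · rank(θ ↦ θ ∧ F_n ∣ ⋀^k)`. -/
theorem sum_finrank_range_blockProj_eq_add (hm : 1 ≤ m) {n : ℕ} (hn : 1 ≤ n) {a c : K} (ha : a ≠ 0) (hc : c ≠ 0) (k : ℕ) :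
    ∑ q ∈ Finset.range (m * (n + 1) + 1),
        finrank K (LinearMap.range (blockProj K m (n + 1) q ∘ₗ
          wedge K (Fin ((m + m) * (n + 1))) k (pairBox K (m := m) (n := n + 1) a c))) =
      finrank K (LinearMap.range (wedge K (Fin ((m + m) * (n + 1))) k (pairBox K (m := m) (n := n + 1) a c))) +
        (n + 1) * finrank K (LinearMap.range (wedge K (Fin ((m + m) * n)) k (pairBox K (m := m) (n := n) a c))) := by
  rw [sum_finrank_range_blockProj_wedge_pairBox K hm n ha hc, finrank_range_pairBox K hm (by omega) ha hc,
    finrank_range_pairBox K hm hn ha hc]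

/-- the single factor (`n + 1 = 1`): **`Σ_{q ≤ m} rank(q-block of θ ↦ θ ∧ f ∣ ⋀^k) = [t^k]P_m + [k = 0]`** — in degree `0` the one
source `1 ↦ a E_X + c E_Y` is counted in the two blocks `q = 0` and `q = m` (th-6's `k = 0` exception, one factor), in every degree
`k ≥ 1` the blocks of one point pair are disjoint. -/
theorem sum_finrank_range_blockProj_wedge_pairBox_one (hm : 1 ≤ m) {a c : K} (ha : a ≠ 0) (hc : c ≠ 0) (k : ℕ) :
    ∑ q ∈ Finset.range (m * 1 + 1),
        finrank K (LinearMap.range (blockProj K m 1 q ∘ₗ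
          wedge K (Fin ((m + m) * 1)) k (pairBox K (m := m) (n := 1) a c))) =
      (pairPoly m).coeff k + (if k = 0 then 1 else 0) := by
  rw [sum_finrank_range_blockProj_wedge_pairBox K hm 0 ha hc, zero_add, pow_one, one_mul, pow_zero, coeff_one]

/-- the instance of record at `m = 3`: the triple box (`n = 3`) of threefold point pairs in degree `2` has block sum
`270 = 126 + 3·48` — the pre-registered row `(36,9,54,36,36,54,9,36,0,0)` of `FormulaNPerQUniform.genCount_predictions_three` summed,
against the total ranks `126 = [t²](1+6t+6t²+t³)³` and `48 = [t²](1+6t+6t²+t³)²` of `WedgePointPairPowers.coeff_pairPoly_three`. -/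
theorem overlap_instance_threefold_triple {a c : K} (ha : a ≠ 0) (hc : c ≠ 0) :
    ∑ q ∈ Finset.range 10,
        finrank K (LinearMap.range (blockProj K 3 3 q ∘ₗ
          wedge K (Fin ((3 + 3) * 3)) 2 (pairBox K (m := 3) (n := 3) a c))) = 126 + 3 * 48 := by
  rw [show Finset.range 10 = Finset.range (3 * (2 + 1) + 1) from rfl,
    sum_finrank_range_blockProj_wedge_pairBox K (m := 3) (by norm_num) 2 ha hc, coeff_pairPoly_three.2.1,
    coeff_pairPoly_three.2.2]

/-- the identity as ARITHMETIC of p10's enumerator (`FormulaNPerQUniform.genCount`, via the rank theorem over `ℚ`):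
**`Σ_{q ≤ m(n+1)} genCount m (n+1) k q = [t^k](pairPoly m)^{n+1} + (n+1)·[t^k](pairPoly m)ⁿ`** for every `m ≥ 1`, `n`, `k` —
a kernel identity between `[t^k u^q] G_{m,n+1}` summed over `q` and the coefficients of `P_m`'s powers, obtained from linear algebra,
not from the generating functions. -/
theorem sum_genCount (hm : 1 ≤ m) (n k : ℕ) :
    ∑ q ∈ Finset.range (m * (n + 1) + 1), FormulaN.Uniform.genCount m (n + 1) k q =
      (pairPoly m ^ (n + 1)).coeff k + (n + 1) * (pairPoly m ^ n).coeff k := by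
  have h := sum_finrank_range_blockProj_wedge_pairBox ℚ hm n one_ne_zero one_ne_zero k
  simp_rw [finrank_range_blockProj_wedge_pairBox ℚ hm one_ne_zero one_ne_zero] at h
  exact h

/-! ## §5. th-7 §G's `η`-WEIGHTS, every `m`: the weight blocks of the point-pair box are the `q`-blocks, `w = mn − k − 2q` -/

variable (m n) in
/-- th-7 PART B §G's `η`-weight of a target monomial (quoted convention, as in `WedgeBoxPerQOverlap.kweight` and
`WedgeSurfacePowersPerQOverlap.kweight`: `+1` per `X`-letter, `−1` per `Y`-letter): `w(T) = #(T ∩ XX) − #(T ∖ XX)`. -/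
def kweight (T : Finset (Fin ((m + m) * n))) : ℤ := ((T ∩ XX m n).card : ℤ) - ((T \ XX m n).card : ℤ)

/-- the `X`-generators number `mn`. -/
lemma card_XX : (XX m n).card = m * n := by
  rw [XX, Finset.card_biUnion]
  · simp_rw [card_lift]
    rw [WedgePair.card_Xset, Finset.sum_const, Finset.card_univ, Fintype.card_fin, smul_eq_mul, mul_comm]
  · intro i _ i' _ h
    exact disjoint_of_subsets (disjoint_D h) (lift_subset_D i _) (lift_subset_D i' _)

/-- **`η`-weight and Dolbeault index are affinely related on the degree-`(k + mn)` monomials: `w = mn − k − 2q`** — so th-7 §G's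
weight blocks of `θ ↦ θ ∧ F ∣ ⋀^k` ARE the `q`-blocks for every factor dimension `m` (same statement as the two-factor
`WedgeBoxPerQOverlap.kweight_eq` and the surface `WedgeSurfacePowersPerQOverlap.kweight_eq`), and every rank statement of
`WedgePointPairPowersPerQRank.lean` reads verbatim for the weight-`w` block with `q = (mn − k − w)/2`. -/
theorem kweight_eq {k : ℕ} {T : Finset (Fin ((m + m) * n))} (hT : T.card = k + m * n) :
    kweight m n T = (m * n : ℤ) - k - 2 * (qdeg m n T : ℤ) := by
  have h1 : (T ∩ XX m n).card + (XX m n \ T).card = m * n := by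
    rw [← card_XX (m := m) (n := n), ← Finset.card_sdiff_add_card_inter (XX m n) T, Finset.inter_comm, add_comm]
  have h2 : (T ∩ XX m n).card + (T \ XX m n).card = k + m * n := by
    rw [← hT, ← Finset.card_inter_add_card_sdiff T (XX m n)]
  unfold kweight qdeg
  omega

/-! ## §6. The edge `m = 2`: `pairPoly 2 = 1 + 4t + t²` -/

/-- **EDGE `m = 2`**: the surface point pair's rank polynomial `pairPoly 2` IS `WedgeSurfacePowers.surfPoly = 1 + 4t + t²`, so §4 at
`m = 2` reads `Σ_{q ≤ 2(n+1)} rank_q = [t^k](1+4t+t²)^{n+1} + (n+1)·[t^k](1+4t+t²)ⁿ` — the right-hand side of the surface identity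
`WedgeSurfacePowersPerQOverlap.sum_finrank_range_blockProj_wedge_surfaceBox` (there in the `Fin (4n)` layout of
`WedgeSurfacePowers.lean`; the two models are not literally identified). -/
theorem pairPoly_two_eq_surfPoly : pairPoly 2 = SurfacePowers.surfPoly := by
  ext k
  rw [coeff_pairPoly, SurfacePowers.coeff_surfPoly]
  by_cases hk : k ≤ 2
  · rw [if_pos hk, ← SurfacePowers.coeff_surfPoly, SurfacePowers.coeff_surfPoly_eq_pointPairRank hk]
  · rw [if_neg hk, if_neg (by omega), if_neg (by omega), if_neg (by omega)]

/-- §4 at `m = 2` with `surfPoly`: `Σ_{q ≤ 2(n+1)} rank_q = [t^k](1+4t+t²)^{n+1} + (n+1)·[t^k](1+4t+t²)ⁿ` for the `(n+1)`-fold box of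
SURFACE point pairs in this file's layout (every `n`, every `k`). -/
theorem sum_finrank_range_blockProj_wedge_pairBox_two (n : ℕ) {a c : K} (ha : a ≠ 0) (hc : c ≠ 0) (k : ℕ) :
    ∑ q ∈ Finset.range (2 * (n + 1) + 1),
        finrank K (LinearMap.range (blockProj K 2 (n + 1) q ∘ₗ
          wedge K (Fin ((2 + 2) * (n + 1))) k (pairBox K (m := 2) (n := n + 1) a c))) =
      (SurfacePowers.surfPoly ^ (n + 1)).coeff k + (n + 1) * (SurfacePowers.surfPoly ^ n).coeff k := by
  rw [sum_finrank_range_blockProj_wedge_pairBox K (m := 2) (by norm_num) n ha hc, pairPoly_two_eq_surfPoly]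

/-! ## §7. Under saturation the block ranks OF `σ` are these numbers ((S2) ⇒ per-q, every `m`, inputs by value) -/

section Saturation

variable {Ext2 : Type*} [AddCommGroup Ext2] [Module K Ext2] [FiniteDimensional K Ext2]

/-- **(S2) ⇒ PER-q FOR THE `n`-FOLD BOX OF `m`-DIMENSIONAL POINT PAIRS** (STRUCTURE (S2) «δ_E = 0 ⇒ σ_E injective in EVERY degree
(saturation: ev onto)» combined with the general per-q rank theorem; the bridge `σ ∘ ev = (θ ↦ θ ∧ F_n)` ([BF08] 6.4.2, on paper) and
the EXTREMAL count `dim Ext^k(F_n, F_n) = [t^k]P_m(t)ⁿ` are HYPOTHESES BY VALUE, as in `FormulaN.Uniform.model_saturation` and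
`WedgeSurfacePowersPerQOverlap.finrank_range_blockProj_sigma_of_saturation`): for ANY finite-dimensional `Ext2`,
`ev : ⋀^k K^{(m+m)n} → Ext2`, `σ : Ext2 → ⋀ K^{(m+m)n}` with `σ ∘ ev = (θ ↦ θ ∧ F_n)` and `dim Ext2 = [t^k](pairPoly m)ⁿ`
(`m, n ≥ 1`), `ev` is onto, `σ` is injective, and **the `q`-block of `σ` ITSELF has rank `genCount m n k q = [t^k u^q] G_{m,n}`** for
every `q`.  Nothing here identifies `Ext2` with an Ext group of a sheaf. -/
theorem finrank_range_blockProj_sigma_of_saturation (hm : 1 ≤ m) (hn : 1 ≤ n) {a c : K} (ha : a ≠ 0) (hc : c ≠ 0) (k : ℕ)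
    (ev : (⋀[K]^k (Fin ((m + m) * n) → K)) →ₗ[K] Ext2) (σ : Ext2 →ₗ[K] HT K (Fin ((m + m) * n)))
    (bridge : σ ∘ₗ ev = wedge K (Fin ((m + m) * n)) k (pairBox K (m := m) (n := n) a c))
    (hExt : finrank K Ext2 = (pairPoly m ^ n).coeff k) (q : ℕ) :
    Function.Surjective ev ∧ Function.Injective σ ∧
      finrank K (LinearMap.range (blockProj K m n q ∘ₗ σ)) = FormulaN.Uniform.genCount m n k q := by
  obtain ⟨hsurj, hinj, -, -, -⟩ :=
    FormulaN.Squeeze.theoremS ev σ _ bridge _ (finrank_range_pairBox K hm hn ha hc k) hExt.le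
  refine ⟨hsurj, hinj, ?_⟩
  rw [WedgeBox.range_comp_eq_of_bridge_of_surjective K ev σ _ bridge hsurj, finrank_range_blockProj_wedge_pairBox K hm ha hc]

end Saturation

end Summit.Ventures.HSemireg.Wedge.PairPowers
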